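import Literature.Analysis.Complex.CauchyPompeiu
import Literature.Analysis.Complex.HartmanWintner
import Literature.Analysis.Complex.SimilarityFactorisationC1
import Literature.Topology.PlaneTopology.WindingPowers
import Literature.Topology.PlaneTopology.ZerosPersist
import HarnessLib

/-!
# A solution of `‖∂̄f‖ ≤ M‖f‖` on the Riemann sphere vanishes identically or nowhere

A function on the Riemann sphere `S² = ℂ_z ∪ ℂ_w` (`w = 1/z`) is given by its two chart readings
`f₀ f₁ : ℂ → ℂ` with the clutching relation `f₁ w = f₀ w⁻¹` (`w ≠ 0`).  Suppose both readings are
smooth and satisfy the Cauchy–Riemann inequality `‖∂̄ fᵢ‖ ≤ M ‖fᵢ‖` on the disc of radius `3`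
of their chart (`∂̄ = Literature.Analysis.Complex.dbarAlong 1 = ½(∂ₓ + i∂_y)`; the two discs cover
the sphere).  Then (`zero_or_forall_ne_zero_of_dbar_le`)

  EITHER `f₀ ≡ 0` (hence `f₁ ≡ 0`), OR `f₀` and `f₁` have no zeros at all.

This is the similarity-principle input of automatic transversality for the linearised
Cauchy–Riemann operator `∂̄ + A` on the trivial line bundle over `S²` (C. Wendl, *Holomorphic
Curves in Low Dimensions* (2018), Prop. 2.47 with Thm. 2.49 and the proof of Prop. 2.53, case
`c₁ = 0`): an element of `ker (∂̄ + A)` satisfies `‖∂̄f‖ ≤ ‖A‖_∞ ‖f‖`, its zeros are isolated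
and of positive local index (similarity principle), and the indices of the zeros of a function on
the sphere add up to the Euler number `0` of the trivial bundle — so there are none.

## The argument

* Local dichotomy (`eventually_eq_zero_or_ne_zero`): at every zero, `f₀` vanishes identically
  nearby or has an isolated zero — the Hartman–Wintner theorem
  `Literature.Analysis.Complex.hartmanWintner_zero_dichotomy` in the chart whose disc of radius
  `3` contains the point (zeros of `f₀` with `‖z‖ ≥ 3` are zeros of `f₁` with `‖w‖ ≤ 1/3`, and the
  inversion is a local homeomorphism).
* All or finitely many (`zeroSet_eq_univ_or_finite`, the argument of Wendl 2018 Thm. 2.49): the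
  interior of the closed zero set is closed, hence `∅` or `ℂ`; in the first case the zero set is
  discrete and, by the dichotomy for `f₁` at `w = 0`, bounded, hence finite.
* Leading terms (`exists_tendsto_div_sub_pow`): at an isolated zero `a`,
  `f z / (z - a)^m → C ≠ 0` with `m ≥ 1` — the `C¹` similarity principle
  `Literature.Analysis.Complex.similarity_leadingTerm_C1` (Wendl 2020, Cor. B.21), translated.
* Index of a disc (`wind_circleLoop_eq_sum`): for `f` continuous with finitely many zeros `a`
  in the open disc `‖z‖ < R`, none on its boundary, and leading terms `C_a (z - a)^{m_a}`, the
  winding number of `f` along `‖z‖ = R` is `∑ m_a` — divide the zeros out one at a time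
  (`f / (z - a)^{m_a}` extends continuously and zero-free across `a`), ending with a zero-free
  function on the closed disc, which has a logarithm
  (`Literature.Topology.PlaneTopology.hasLogOn_closedBall`) and index `0`.
* Inversion (`wind_circleLoop_eq_neg_of_inversion`): `(R e^{2πit})⁻¹ = R⁻¹ e^{-2πit}`, so the
  index of `f₀` along `‖z‖ = R` is MINUS the index of `f₁` along `‖w‖ = R⁻¹`
  (`Literature.Topology.PlaneTopology.wind_comp_intCast_mul` with `d = -1`).
* Assembly: choose `R ∈ [1, 2]` avoiding the (finitely many) moduli of the zeros; the disc
  `‖z‖ ≤ R` lies in the first chart's disc of radius `3`, the disc `‖w‖ ≤ R⁻¹ ≤ 1` in the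
  second's; the two index formulas and the inversion give `∑ m_a + ∑ m_b = 0` with all
  `m ≥ 1`, so both discs — i.e. the whole sphere — are free of zeros.

Everything is proved; no named facts, no new definitions.  The elementary index count replaces
the homological degree argument (Bredon 1993, VI.12) used for the same purpose in
`Literature/Geometry/Symplectic/SphereIntersectionIndexHomologicalNoncompact.lean`.

## References

* C. Wendl, *Holomorphic Curves in Low Dimensions*, LNM 2216 (2018), Prop. 2.47, Thm. 2.49,
  Prop. 2.53. [Wendl2018]
* C. Wendl, *Lectures on Contact 3-Manifolds, Holomorphic Curves and Intersection Theory* (2020),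
  App. B, Thm. B.20, Cor. B.21. [Wendl2020]
* D. McDuff, D. Salamon, *J-holomorphic curves and symplectic topology*, 2nd ed. (2012), §2.3.
  [McDuffSalamon2012]
-/

noncomputable section

open Set Function Filter Metric Complex
open scoped Real ContDiff Topology
open Literature.Topology.PlaneTopology

namespace Literature.Analysis.Complex.RiemannSphere

namespace DbarInequalityDichotomy

/-! ### Circle loops about the origin and the inversion `z ↦ z⁻¹` -/

/-- Circle loops are `1`-periodic. [folklore] -/
theorem periodic_circleLoop (c : ℂ) (R : ℝ) : Periodic (circleLoop c R) 1 := fun t => by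
  show circleMap c R (2 * π * (t + 1)) = circleMap c R (2 * π * t)
  rw [mul_add, mul_one]
  exact periodic_circleMap c R _

/-- A circle loop about the origin of radius `R ≥ 0` has constant modulus `R`. [folklore] -/
theorem norm_circleLoop_origin {R : ℝ} (hR : 0 ≤ R) (t : ℝ) : ‖circleLoop 0 R t‖ = R := by
  simpa [abs_of_nonneg hR] using norm_circleLoop_sub_center 0 R t

/-- Inversion reflects the parameter of circles about the origin:
`(R e^{2πit})⁻¹ = R⁻¹ e^{-2πit}`. [folklore] -/
theorem circleLoop_origin_inv (R t : ℝ) : (circleLoop 0 R t)⁻¹ = circleLoop 0 R⁻¹ (-t) := by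
  rw [circleLoop_apply, circleLoop_apply, zero_add, zero_add, mul_inv, ← Complex.exp_neg,
    ofReal_inv, ofReal_neg]
  congr 2
  ring

/-- Reversing the parameter negates the winding number (the case `d = -1` of
`wind_comp_intCast_mul`). [folklore] -/
theorem wind_comp_neg {F : ℝ → ℂ} (hF : Continuous F) (hne : ∀ t, F t ≠ 0)
    (hp : Periodic F 1) : wind (fun t => F (-t)) = -wind F := by
  have h := wind_comp_intCast_mul hF hne hp (-1)
  simp only [Int.cast_neg, Int.cast_one, neg_mul, one_mul] at h
  exact h

/-- **Inversion reverses the index at the origin.** If `f₁ w = f₀ w⁻¹` off the origin and `f₁`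
is continuous and zero-free on the circle `‖w‖ = R⁻¹` (`R > 0`), then
`wind (f₀ ∘ circleLoop 0 R) = - wind (f₁ ∘ circleLoop 0 R⁻¹)`: the loop `t ↦ (R e^{2πit})⁻¹`
is the circle of radius `R⁻¹` run backwards. [folklore] -/
theorem wind_circleLoop_eq_neg_of_inversion {f₀ f₁ : ℂ → ℂ} {R : ℝ} (hR : 0 < R)
    (hrel : ∀ w : ℂ, w ≠ 0 → f₁ w = f₀ w⁻¹) (hf₁ : Continuous f₁)
    (hne : ∀ w : ℂ, ‖w‖ = R⁻¹ → f₁ w ≠ 0) :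
    wind (fun t => f₀ (circleLoop 0 R t)) = -wind (fun t => f₁ (circleLoop 0 R⁻¹ t)) := by
  have h : wind (fun t => f₁ (circleLoop 0 R⁻¹ (-t))) =
      -wind (fun t => f₁ (circleLoop 0 R⁻¹ t)) :=
    wind_comp_neg (F := fun t => f₁ (circleLoop 0 R⁻¹ t))
      (hf₁.comp (continuous_circleLoop 0 R⁻¹))
      (fun t => hne _ (norm_circleLoop_origin (inv_pos.2 hR).le t))
      ((periodic_circleLoop 0 R⁻¹).comp f₁)
  rw [← h]
  congr 1
  funext t
  have h0 : circleLoop 0 R t ≠ 0 := fun h0 => by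
    have := norm_circleLoop_origin hR.le t
    rw [h0, norm_zero] at this
    exact hR.ne' this.symm
  rw [← circleLoop_origin_inv, hrel _ (inv_ne_zero h0), inv_inv]

/-! ### The index of a disc with finitely many zeros of known leading terms -/

/-- **The index of a disc is the sum of the multiplicities of the zeros inside.** Let `f` be
continuous on `ℂ`, `Z` a finite set of points of the open disc `‖z‖ < R` containing every zero
of `f` in the closed disc `‖z‖ ≤ R`, and suppose that at each `a ∈ Z` the function has a leading
term: `f z / (z - a) ^ (m a) → C a ≠ 0` as `z → a`.  Then the winding number of `f` along the
circle `‖z‖ = R` is `∑_{a ∈ Z} m a`.  Proof by induction on `Z`: `f / (z - a)^{m a}` extends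
continuously across `a` with the nonzero value `C a`, has the remaining zeros with leading terms
`C b / (b - a)^{m a}`, and `wind (f ∘ γ) = wind ((f/(z-a)^{m a}) ∘ γ) + m a`; a zero-free
continuous function on the closed disc has a logarithm there, hence index `0`. [folklore] -/
theorem wind_circleLoop_eq_sum {R : ℝ} (hR : 0 < R) (m : ℂ → ℕ) (Z : Finset ℂ) :
    ∀ (f C : ℂ → ℂ), Continuous f → (∀ z : ℂ, ‖z‖ ≤ R → f z = 0 → z ∈ Z) →
      (∀ a ∈ Z, ‖a‖ < R) → (∀ a ∈ Z, C a ≠ 0) →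
      (∀ a ∈ Z, Tendsto (fun z => f z / (z - a) ^ m a) (𝓝[≠] a) (𝓝 (C a))) →
      wind (fun t => f (circleLoop 0 R t)) = ∑ a ∈ Z, (m a : ℤ) := by
  classical
  induction Z using Finset.induction_on with
  | empty =>
    intro f C hf hzero _ _ _
    rw [Finset.sum_empty]
    have hne : ∀ z ∈ closedBall (0 : ℂ) R, f z ≠ 0 := fun z hz h0 =>
      Finset.notMem_empty z (hzero z (mem_closedBall_zero_iff.1 hz) h0)
    exact wind_comp_eq_zero_of_hasLogOn (hasLogOn_closedBall hf.continuousOn hne)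
      (continuous_circleLoop 0 R).continuousOn
      (fun t _ => sphere_subset_closedBall (circleLoop_mem_sphere 0 hR.le t))
      (circleLoop_zero_eq 0 R)
  | insert a Z haZ ih =>
    intro f C hf hzero hnorm hC hT
    have ha : a ∈ insert a Z := Finset.mem_insert_self a Z
    have haR : ‖a‖ < R := hnorm a ha
    have hpow : ∀ z : ℂ, z ≠ a → (z - a) ^ m a ≠ 0 := fun z hz =>
      pow_ne_zero _ (sub_ne_zero.2 hz)
    have hba : ∀ b ∈ Z, b ≠ a := fun b hb h => haZ (h ▸ hb)
    -- divide out the zero at `a`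
    set g : ℂ → ℂ := Function.update (fun z => f z / (z - a) ^ m a) a (C a) with hg
    have hg_of_ne : ∀ z : ℂ, z ≠ a → g z = f z / (z - a) ^ m a := fun z hz =>
      Function.update_of_ne hz _ _
    have hga : g a = C a := by rw [hg, Function.update_self]
    have hf_eq : ∀ z : ℂ, z ≠ a → f z = g z * (z - a) ^ m a := fun z hz => by
      rw [hg_of_ne z hz, div_mul_cancel₀ _ (hpow z hz)]
    have hg_cont : Continuous g := by
      refine continuous_iff_continuousAt.2 fun z => ?_
      rcases eq_or_ne z a with rfl | hz
      · exact continuousAt_update_same.2 (hT _ ha)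
      · exact (continuousAt_update_of_ne hz).2
          ((hf.continuousAt).div (((continuous_id.sub continuous_const).pow _).continuousAt)
            (hpow z hz))
    have hzero' : ∀ z : ℂ, ‖z‖ ≤ R → g z = 0 → z ∈ Z := by
      intro z hzR hgz
      rcases eq_or_ne z a with rfl | hz
      · exact absurd (hga.symm.trans hgz) (hC _ ha)
      · have hfz : f z = 0 := by rw [hf_eq z hz, hgz, zero_mul]
        exact (Finset.mem_insert.1 (hzero z hzR hfz)).resolve_left hz
    have hnorm' : ∀ b ∈ Z, ‖b‖ < R := fun b hb => hnorm b (Finset.mem_insert_of_mem hb)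
    have hC' : ∀ b ∈ Z, C b / (b - a) ^ m a ≠ 0 := fun b hb =>
      div_ne_zero (hC b (Finset.mem_insert_of_mem hb)) (hpow b (hba b hb))
    have hT' : ∀ b ∈ Z, Tendsto (fun z => g z / (z - b) ^ m b) (𝓝[≠] b)
        (𝓝 (C b / (b - a) ^ m a)) := by
      intro b hb
      have h1 : Tendsto (fun z : ℂ => (z - a) ^ m a) (𝓝[≠] b) (𝓝 ((b - a) ^ m a)) :=
        (((continuous_id.sub continuous_const).pow _).tendsto b).mono_left nhdsWithin_le_nhds
      have h2 : Tendsto (fun z => f z / (z - b) ^ m b / (z - a) ^ m a) (𝓝[≠] b)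
          (𝓝 (C b / (b - a) ^ m a)) :=
        (hT b (Finset.mem_insert_of_mem hb)).div h1 (hpow b (hba b hb))
      refine h2.congr' ?_
      have hne : ∀ᶠ z in 𝓝[≠] b, z ≠ a :=
        mem_nhdsWithin_of_mem_nhds (compl_singleton_mem_nhds (hba b hb))
      filter_upwards [hne] with z hz
      rw [hg_of_ne z hz, div_right_comm]
    have hwg := ih g (fun b => C b / (b - a) ^ m a) hg_cont hzero' hnorm' hC' hT'
    -- on the circle `‖z‖ = R`: `f = g · (z - a) ^ m a`, both factors zero-free
    have hγa : ∀ t, circleLoop 0 R t ≠ a := fun t h => by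
      have := norm_circleLoop_origin hR.le t
      rw [h] at this
      exact haR.ne this
    have hγg : ∀ t, g (circleLoop 0 R t) ≠ 0 := fun t h0 => by
      have hmem := hzero' _ (norm_circleLoop_origin hR.le t).le h0
      exact (hnorm' _ hmem).ne (norm_circleLoop_origin hR.le t)
    have hloop_g : IsNonvanishingLoop fun t => g (circleLoop 0 R t) :=
      ⟨(hg_cont.comp (continuous_circleLoop 0 R)).continuousOn, fun t _ => hγg t,
        by rw [circleLoop_zero_eq]⟩
    have hloop_l : IsNonvanishingLoop fun t => circleLoop 0 R t - a :=
      ⟨((continuous_circleLoop 0 R).sub continuous_const).continuousOn,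
        fun t _ => sub_ne_zero.2 (hγa t), by rw [circleLoop_zero_eq]⟩
    have hloop_p : IsNonvanishingLoop fun t => (circleLoop 0 R t - a) ^ m a :=
      ⟨(((continuous_circleLoop 0 R).sub continuous_const).pow _).continuousOn,
        fun t _ => hpow _ (hγa t), by rw [circleLoop_zero_eq]⟩
    have hwp : wind (fun t => (circleLoop 0 R t - a) ^ m a) = m a := by
      have h := wind_zpow hloop_l (m a : ℤ)
      simp only [zpow_natCast] at h
      rw [h, wind_circleLoop_sub_of_norm_lt (by rwa [sub_zero]), mul_one]
    have hcongr : (fun t => f (circleLoop 0 R t)) =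
        fun t => g (circleLoop 0 R t) * (circleLoop 0 R t - a) ^ m a :=
      funext fun t => hf_eq _ (hγa t)
    rw [Finset.sum_insert haZ, ← hwg, hcongr, wind_mul hloop_g hloop_p, hwp]
    ring

/-! ### Leading terms at the zeros (the `C¹` similarity principle, translated) -/

/-- **Leading term at an isolated zero.** If `f` is `C¹` with `‖∂̄ f‖ ≤ M ‖f‖` on the disc
`‖z - a‖ ≤ ρ`, `f a = 0`, and `f` does not vanish identically on the open disc, then
`f z / (z - a) ^ m → C` as `z → a` for some `m ≥ 1` and `C ≠ 0`
(`Literature.Analysis.Complex.similarity_leadingTerm_C1` for `z ↦ f (z + a)`).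
[cite: Wendl2020, Cor. B.21] -/
theorem exists_tendsto_div_sub_pow {f : ℂ → ℂ} {a : ℂ} {M ρ : ℝ} (hf : ContDiff ℝ 1 f)
    (hbound : ∀ z : ℂ, ‖z - a‖ ≤ ρ → ‖dbarAlong 1 f z‖ ≤ M * ‖f z‖) (h0 : f a = 0)
    (hne : ∃ z : ℂ, ‖z - a‖ < ρ ∧ f z ≠ 0) :
    ∃ (m : ℕ) (C : ℂ), 1 ≤ m ∧ C ≠ 0 ∧
      Tendsto (fun z => f z / (z - a) ^ m) (𝓝[≠] a) (𝓝 C) := by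
  set c : ℂ → ℂ := fun z => f (z + a) with hc
  have hcd : ContDiff ℝ 1 c := hf.comp (contDiff_id.add contDiff_const)
  have hcb : ∀ η : ℂ, ‖η‖ ≤ ρ → ‖dbarAlong 1 c η‖ ≤ M * ‖c η‖ := by
    intro η hη
    have he : dbarAlong 1 c η = dbarAlong 1 f (η + a) := by
      rw [dbarAlong_apply, dbarAlong_apply, hc, fderiv_comp_add_right]
    rw [he]
    exact hbound _ (by rwa [add_sub_cancel_right])
  have hc0 : c 0 = 0 := by simp [hc, h0]
  have hcne : ∃ z : ℂ, ‖z‖ < ρ ∧ c z ≠ 0 := by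
    obtain ⟨z, hz, hfz⟩ := hne
    exact ⟨z - a, hz, by simpa [hc] using hfz⟩
  obtain ⟨m, C, hm, hC, hT⟩ := similarity_leadingTerm_C1 c M ρ hcd hcb hc0 hcne
  refine ⟨m, C, hm, hC, ?_⟩
  have hsub : Tendsto (fun z : ℂ => z - a) (𝓝[≠] a) (𝓝[≠] 0) := by
    refine tendsto_nhdsWithin_of_tendsto_nhds_of_eventually_within _ ?_ ?_
    · have h := (continuous_sub_right a).tendsto a
      rw [sub_self] at h
      exact h.mono_left nhdsWithin_le_nhds
    · filter_upwards [self_mem_nhdsWithin] with z hz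
      exact sub_ne_zero.2 hz
  have key : (fun z => c z / z ^ m) ∘ (fun z => z - a) = fun z => f z / (z - a) ^ m := by
    funext z
    simp [hc]
  rw [← key]
  exact hT.comp hsub

/-! ### All or finitely many zeros -/

/-- **The zero set of a continuous two-chart function with only interior-or-isolated zeros is
all of `ℂ` or finite** (the argument of Wendl 2018, Thm. 2.49, first assertion): the interior of
the closed zero set is closed, hence `∅` or `ℂ`; in the first case every zero is isolated and,
by the dichotomy for the second chart at `w = 0`, the zero set is bounded, hence compact and
discrete, hence finite. [cite: Wendl2018, Thm. 2.49] -/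
theorem zeroSet_eq_univ_or_finite (h₀ h₁ : ℂ → ℂ) (hh₀ : Continuous h₀) (hh₁ : Continuous h₁)
    (hrel : ∀ w : ℂ, w ≠ 0 → h₁ w = h₀ w⁻¹)
    (key : ∀ z₀ : ℂ, h₀ z₀ = 0 → (∀ᶠ z in 𝓝 z₀, h₀ z = 0) ∨ (∀ᶠ z in 𝓝[≠] z₀, h₀ z ≠ 0))
    (key₁ : h₁ 0 = 0 → (∀ᶠ w in 𝓝 (0 : ℂ), h₁ w = 0) ∨ (∀ᶠ w in 𝓝[≠] (0 : ℂ), h₁ w ≠ 0)) :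
    {z : ℂ | h₀ z = 0} = Set.univ ∨ {z : ℂ | h₀ z = 0}.Finite := by
  -- adapted from Summits/SmoothPoincare4/SmoothPoincare4/Theorems/
  --   SymplecticOrigamiGromovRecognitionRelEndHelperTwoChartZeroSetUnivOrFinite.lean
  set S : Set ℂ := {z : ℂ | h₀ z = 0} with hS
  have hSc : IsClosed S := isClosed_eq hh₀ continuous_const
  -- the interior of `S` is closed
  have hclosed : IsClosed (interior S) := by
    refine isClosed_of_closure_subset fun z₁ hz₁ => ?_
    have hz₁S : z₁ ∈ S := closure_minimal interior_subset hSc hz₁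
    rcases key z₁ hz₁S with h | h
    · exact mem_interior_iff_mem_nhds.2 h
    · rw [eventually_nhdsWithin_iff] at h
      obtain ⟨z₂, hz₂, hz₂'⟩ := mem_closure_iff_nhds.1 hz₁ _ h
      by_cases hne : z₂ = z₁
      · exact hne ▸ hz₂'
      · have hz₂S : z₂ ∈ S := interior_subset hz₂'
        exact absurd hz₂S (hz₂ hne)
  rcases isClopen_iff.1 ⟨hclosed, isOpen_interior⟩ with h0 | h1
  · -- every zero is isolated; bounded via `h₁` at `0`; hence finite
    right
    have hiso : ∀ z₀ ∈ S, ∀ᶠ z in 𝓝[≠] z₀, z ∉ S := fun z₀ hz₀ =>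
      (key z₀ hz₀).resolve_left fun h => by
        have hmem : z₀ ∈ interior S := mem_interior_iff_mem_nhds.2 h
        rw [h0] at hmem
        exact hmem
    have hbd : ∀ᶠ w in 𝓝[≠] (0 : ℂ), h₁ w ≠ 0 := by
      by_cases h10 : h₁ 0 = 0
      · rcases key₁ h10 with h | h
        · exfalso
          obtain ⟨δ, hδ, hball⟩ := Metric.eventually_nhds_iff_ball.1 h
          have hsub : {z : ℂ | δ⁻¹ < ‖z‖} ⊆ S := fun z hz => by
            have hzpos : 0 < ‖z‖ := lt_trans (inv_pos.2 hδ) hz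
            have hz0 : z ≠ 0 := norm_pos_iff.1 hzpos
            have hmem : h₁ z⁻¹ = 0 := hball _ (by
              rw [mem_ball, dist_zero_right, norm_inv]
              exact inv_lt_of_inv_lt₀ hδ hz)
            show h₀ z = 0
            rwa [hrel _ (inv_ne_zero hz0), inv_inv] at hmem
          have hopen : IsOpen {z : ℂ | δ⁻¹ < ‖z‖} := isOpen_lt continuous_const continuous_norm
          have hpt : ((2 * δ⁻¹ : ℝ) : ℂ) ∈ interior S := by
            refine interior_maximal hsub hopen ?_
            show δ⁻¹ < ‖((2 * δ⁻¹ : ℝ) : ℂ)‖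
            rw [Complex.norm_real, Real.norm_eq_abs, abs_of_pos (by positivity)]
            linarith [inv_pos.2 hδ]
          rw [h0] at hpt
          exact hpt
        · exact h
      · exact eventually_nhdsWithin_of_eventually_nhds
          ((hh₁.tendsto 0).eventually (isOpen_compl_singleton.mem_nhds h10))
    rw [eventually_nhdsWithin_iff, Metric.eventually_nhds_iff_ball] at hbd
    obtain ⟨δ, hδ, hδball⟩ := hbd
    have hSbdd : S ⊆ closedBall 0 δ⁻¹ := fun z hz => by
      by_contra hfar
      rw [mem_closedBall, dist_zero_right, not_le] at hfar
      have hzpos : 0 < ‖z‖ := lt_trans (inv_pos.2 hδ) hfar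
      have hz0 : z ≠ 0 := norm_pos_iff.1 hzpos
      have h1 : z⁻¹ ∈ ball (0 : ℂ) δ := by
        rw [mem_ball, dist_zero_right, norm_inv]
        exact inv_lt_of_inv_lt₀ hδ hfar
      have h2 := hδball _ h1 (by simpa using hz0)
      rw [hrel _ (inv_ne_zero hz0), inv_inv] at h2
      exact h2 hz
    have hScpt : IsCompact S := (isCompact_closedBall 0 δ⁻¹).of_isClosed_subset hSc hSbdd
    set U : ℂ → Set ℂ := fun z => {y : ℂ | y ∈ ({z}ᶜ : Set ℂ) → y ∉ S} with hU
    have hUn : ∀ z ∈ S, U z ∈ 𝓝 z := fun z hz => by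
      have h := hiso z hz
      rw [eventually_nhdsWithin_iff] at h
      exact h
    obtain ⟨t, -, hcover⟩ := hScpt.elim_nhds_subcover U hUn
    refine t.finite_toSet.subset fun z hz => ?_
    obtain ⟨x, hxt, hzU⟩ := mem_iUnion₂.1 (hcover hz)
    by_cases hzx : z = x
    · rw [hzx]
      exact hxt
    · exact absurd hz (hzU hzx)
  · left
    exact eq_univ_of_univ_subset (h1 ▸ interior_subset)

/-! ### The local dichotomy on the sphere from Hartman–Wintner -/

/-- A point of the ball `B(c, ρ - ‖c‖)` has modulus `< ρ`. [folklore] -/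
theorem norm_lt_of_mem_ball_sub {c w : ℂ} {ρ : ℝ} (hw : w ∈ ball c (ρ - ‖c‖)) : ‖w‖ < ρ := by
  rw [mem_ball_iff_norm] at hw
  calc ‖w‖ = ‖(w - c) + c‖ := by rw [sub_add_cancel]
    _ ≤ ‖w - c‖ + ‖c‖ := norm_add_le _ _
    _ < ρ := by linarith

/-- **Local dichotomy at a zero of the first chart.** Under the hypotheses of
`zero_or_forall_ne_zero_of_dbar_le` (with `C¹` readings), at every zero `z₀` of `f₀` either
`f₀ ≡ 0` nearby or `z₀` is an isolated zero: Hartman–Wintner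
(`Literature.Analysis.Complex.hartmanWintner_zero_dichotomy`) for `f₀` on `B(z₀, 3 - ‖z₀‖)`
if `‖z₀‖ < 3`, and otherwise for `f₁` on `B(z₀⁻¹, 3 - ‖z₀⁻¹‖)`, transported back through the
local homeomorphism `z ↦ z⁻¹`. [folklore] -/
theorem eventually_eq_zero_or_ne_zero {f₀ f₁ : ℂ → ℂ} {M : ℝ} (hf₀ : ContDiff ℝ 1 f₀)
    (hf₁ : ContDiff ℝ 1 f₁) (hrel : ∀ w : ℂ, w ≠ 0 → f₁ w = f₀ w⁻¹)
    (hd₀ : ∀ z : ℂ, ‖z‖ < 3 → ‖dbarAlong 1 f₀ z‖ ≤ M * ‖f₀ z‖)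
    (hd₁ : ∀ w : ℂ, ‖w‖ < 3 → ‖dbarAlong 1 f₁ w‖ ≤ M * ‖f₁ w‖) {z₀ : ℂ} (hz : f₀ z₀ = 0) :
    (∀ᶠ z in 𝓝 z₀, f₀ z = 0) ∨ (∀ᶠ z in 𝓝[≠] z₀, f₀ z ≠ 0) := by
  by_cases hz3 : ‖z₀‖ < 3
  · -- Hartman–Wintner in the first chart
    exact hartmanWintner_zero_dichotomy (by linarith : (0 : ℝ) < 3 - ‖z₀‖) hf₀.contDiffOn
      (fun z hz' => hd₀ z (norm_lt_of_mem_ball_sub hz')) hz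
  · -- Hartman–Wintner in the second chart, transported through the inversion
    push Not at hz3
    have hz0 : z₀ ≠ 0 := by
      rintro rfl
      norm_num at hz3
    have hw₀ : ‖z₀⁻¹‖ < 3 := by
      rw [norm_inv]
      calc ‖z₀‖⁻¹ ≤ 3⁻¹ := inv_anti₀ (by norm_num) hz3
        _ < 3 := by norm_num
    have hw₀z : f₁ z₀⁻¹ = 0 := by
      rw [hrel _ (inv_ne_zero hz0), inv_inv]
      exact hz
    have key := hartmanWintner_zero_dichotomy (by linarith : (0 : ℝ) < 3 - ‖z₀⁻¹‖)
      hf₁.contDiffOn (fun w hw => hd₁ w (norm_lt_of_mem_ball_sub hw)) hw₀z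
    have hinv : Tendsto (fun z : ℂ => z⁻¹) (𝓝 z₀) (𝓝 z₀⁻¹) := (continuousAt_inv₀ hz0).tendsto
    rcases key with h | h
    · left
      filter_upwards [hinv.eventually h, eventually_ne_nhds hz0] with z hz' hzne
      rwa [hrel _ (inv_ne_zero hzne), inv_inv] at hz'
    · right
      have hinv' : Tendsto (fun z : ℂ => z⁻¹) (𝓝[≠] z₀) (𝓝[≠] z₀⁻¹) :=
        tendsto_nhdsWithin_of_tendsto_nhds_of_eventually_within _
          (hinv.mono_left nhdsWithin_le_nhds)
          (by
            filter_upwards [self_mem_nhdsWithin] with z hz'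
            exact fun h' => hz' (inv_injective h'))
      filter_upwards [hinv'.eventually h,
        mem_nhdsWithin_of_mem_nhds (eventually_ne_nhds hz0)] with z hz' hzne
      rwa [hrel _ (inv_ne_zero hzne), inv_inv] at hz'

end DbarInequalityDichotomy

open DbarInequalityDichotomy

/-- **A solution of a Cauchy–Riemann inequality on the Riemann sphere vanishes identically or
nowhere.** Let `f₀ f₁ : ℂ → ℂ` be smooth chart readings of a function on `S² = ℂ_z ∪ ℂ_w`
(`f₁ w = f₀ w⁻¹` for `w ≠ 0`) with `‖∂̄ f₀ z‖ ≤ M ‖f₀ z‖` for `‖z‖ < 3` and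
`‖∂̄ f₁ w‖ ≤ M ‖f₁ w‖` for `‖w‖ < 3`. Then either `f₀ ≡ 0`, or neither `f₀` nor `f₁` has a
zero.  (Wendl 2018, Prop. 2.47 with Thm. 2.49 / proof of Prop. 2.53 for the trivial line bundle:
zeros of solutions are isolated of positive index by the similarity principle, and the indices
on the sphere sum to `c₁ = 0`; here: Hartman–Wintner, the `C¹` similarity leading term, and an
elementary winding-number count over the two hemispheres `‖z‖ ≤ R`, `‖w‖ ≤ R⁻¹`.)
[cite: Wendl2018, Prop. 2.47] -/
theorem zero_or_forall_ne_zero_of_dbar_le : ∀ (f₀ f₁ : ℂ → ℂ) (M : ℝ), ContDiff ℝ ∞ f₀ →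
    ContDiff ℝ ∞ f₁ → (∀ w : ℂ, w ≠ 0 → f₁ w = f₀ w⁻¹) →
    (∀ z : ℂ, ‖z‖ < 3 → ‖dbarAlong 1 f₀ z‖ ≤ M * ‖f₀ z‖) →
    (∀ w : ℂ, ‖w‖ < 3 → ‖dbarAlong 1 f₁ w‖ ≤ M * ‖f₁ w‖) →
    (∀ z : ℂ, f₀ z = 0) ∨ ((∀ z : ℂ, f₀ z ≠ 0) ∧ ∀ w : ℂ, f₁ w ≠ 0) := by
  intro f₀ f₁ M hf₀ hf₁ hrel hd₀ hd₁
  classical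
  have h1₀ : ContDiff ℝ 1 f₀ := hf₀.of_le (by norm_cast)
  have h1₁ : ContDiff ℝ 1 f₁ := hf₁.of_le (by norm_cast)
  have hc₀ : Continuous f₀ := hf₀.continuous
  have hc₁ : Continuous f₁ := hf₁.continuous
  -- Step 1: the zero set of `f₀` is everything or finite
  rcases zeroSet_eq_univ_or_finite f₀ f₁ hc₀ hc₁ hrel
      (fun z₀ hz₀ => eventually_eq_zero_or_ne_zero h1₀ h1₁ hrel hd₀ hd₁ hz₀)
      (fun h10 => hartmanWintner_zero_dichotomy (by norm_num : (0 : ℝ) < 3) h1₁.contDiffOn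
        (fun w hw => hd₁ w (mem_ball_zero_iff.1 hw)) h10) with huniv | hfin
  · left
    intro z
    have hz : z ∈ ({z : ℂ | f₀ z = 0} : Set ℂ) := by
      rw [huniv]
      trivial
    exact hz
  right
  -- Step 2: finitely many zeros of `f₀`, hence of `f₁`
  have hfin₁ : {w : ℂ | f₁ w = 0}.Finite := by
    refine ((hfin.image fun z : ℂ => z⁻¹).insert 0).subset fun w hw => ?_
    rcases eq_or_ne w 0 with rfl | hw0
    · exact mem_insert _ _
    · refine mem_insert_of_mem _ ⟨w⁻¹, ?_, inv_inv w⟩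
      show f₀ w⁻¹ = 0
      rw [← hrel w hw0]
      exact hw
  -- a radius `R ∈ [1, 2]` avoiding the moduli of the zeros of `f₀`
  obtain ⟨R, hR12, hRZ⟩ := (Icc_infinite (by norm_num : (1 : ℝ) < 2)).exists_notMem_finset
    (hfin.toFinset.image fun z => ‖z‖)
  have hR : 0 < R := by linarith [hR12.1]
  have hRi : 0 < R⁻¹ := inv_pos.2 hR
  have hRi1 : R⁻¹ ≤ 1 := inv_le_one_of_one_le₀ hR12.1
  have hnormR : ∀ z : ℂ, f₀ z = 0 → ‖z‖ ≠ R := fun z hz h =>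
    hRZ (Finset.mem_image.2 ⟨z, hfin.mem_toFinset.2 hz, h⟩)
  -- the zeros in the two closed hemispheres `‖z‖ ≤ R`, `‖w‖ ≤ R⁻¹` lie in the open ones
  set Z₀ : Finset ℂ := hfin.toFinset.filter fun z => ‖z‖ < R with hZ₀
  set Z₁ : Finset ℂ := hfin₁.toFinset.filter fun w => ‖w‖ < R⁻¹ with hZ₁
  have hmem₀ : ∀ z : ℂ, ‖z‖ ≤ R → f₀ z = 0 → z ∈ Z₀ := fun z hzR hz =>
    Finset.mem_filter.2 ⟨hfin.mem_toFinset.2 hz, lt_of_le_of_ne hzR (hnormR z hz)⟩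
  have hmem₁ : ∀ w : ℂ, ‖w‖ ≤ R⁻¹ → f₁ w = 0 → w ∈ Z₁ := by
    intro w hwR hw
    refine Finset.mem_filter.2 ⟨hfin₁.mem_toFinset.2 hw, lt_of_le_of_ne hwR fun h => ?_⟩
    have hw0 : w ≠ 0 := by
      rintro rfl
      rw [norm_zero] at h
      exact hRi.ne h
    have hz : f₀ w⁻¹ = 0 := by
      rw [← hrel w hw0]
      exact hw
    exact hnormR _ hz (by rw [norm_inv, h, inv_inv])
  have hZ₀R : ∀ a ∈ Z₀, ‖a‖ < R := fun a ha => (Finset.mem_filter.1 ha).2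
  have hZ₁R : ∀ b ∈ Z₁, ‖b‖ < R⁻¹ := fun b hb => (Finset.mem_filter.1 hb).2
  have hZ₀z : ∀ a ∈ Z₀, f₀ a = 0 := fun a ha => hfin.mem_toFinset.1 (Finset.mem_filter.1 ha).1
  have hZ₁z : ∀ b ∈ Z₁, f₁ b = 0 := fun b hb => hfin₁.mem_toFinset.1 (Finset.mem_filter.1 hb).1
  -- Step 3: leading terms at the zeros (similarity principle; the zeros are isolated)
  have hlead₀ : ∀ a ∈ Z₀, ∃ (m : ℕ) (C : ℂ), 1 ≤ m ∧ C ≠ 0 ∧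
      Tendsto (fun z => f₀ z / (z - a) ^ m) (𝓝[≠] a) (𝓝 C) := by
    intro a ha
    refine exists_tendsto_div_sub_pow (ρ := 1 / 2) h1₀ (fun z hz => hd₀ z ?_) (hZ₀z a ha) ?_
    · calc ‖z‖ = ‖(z - a) + a‖ := by rw [sub_add_cancel]
        _ ≤ ‖z - a‖ + ‖a‖ := norm_add_le _ _
        _ < 3 := by linarith [hZ₀R a ha, hR12.2]
    · by_contra h
      push Not at h
      have hS : {z : ℂ | f₀ z = 0} ∈ 𝓝 a := mem_of_superset (ball_mem_nhds a one_half_pos)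
        fun z hz => h z (mem_ball_iff_norm.1 hz)
      exact infinite_of_mem_nhds a hS hfin
  have hlead₁ : ∀ b ∈ Z₁, ∃ (m : ℕ) (C : ℂ), 1 ≤ m ∧ C ≠ 0 ∧
      Tendsto (fun w => f₁ w / (w - b) ^ m) (𝓝[≠] b) (𝓝 C) := by
    intro b hb
    refine exists_tendsto_div_sub_pow (ρ := 1) h1₁ (fun w hw => hd₁ w ?_) (hZ₁z b hb) ?_
    · calc ‖w‖ = ‖(w - b) + b‖ := by rw [sub_add_cancel]
        _ ≤ ‖w - b‖ + ‖b‖ := norm_add_le _ _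
        _ < 3 := by linarith [hZ₁R b hb]
    · by_contra h
      push Not at h
      have hS : {w : ℂ | f₁ w = 0} ∈ 𝓝 b := mem_of_superset (ball_mem_nhds b one_pos)
        fun w hw => h w (mem_ball_iff_norm.1 hw)
      exact infinite_of_mem_nhds b hS hfin₁
  choose! m₀ C₀ hm₀ hC₀ hT₀ using hlead₀
  choose! m₁ C₁ hm₁ hC₁ hT₁ using hlead₁
  -- Step 4: the indices of the two hemispheres, related by the inversion
  have hw₀ := wind_circleLoop_eq_sum hR m₀ Z₀ f₀ C₀ hc₀ hmem₀ hZ₀R hC₀ hT₀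
  have hw₁ := wind_circleLoop_eq_sum hRi m₁ Z₁ f₁ C₁ hc₁ hmem₁ hZ₁R hC₁ hT₁
  have hcirc : ∀ w : ℂ, ‖w‖ = R⁻¹ → f₁ w ≠ 0 := fun w hw h0 =>
    (hZ₁R w (hmem₁ w hw.le h0)).ne hw
  have hinv := wind_circleLoop_eq_neg_of_inversion hR hrel hc₁ hcirc
  -- Step 5: a vanishing sum of positive multiplicities is empty
  have hsum : (∑ a ∈ Z₀, (m₀ a : ℤ)) + ∑ b ∈ Z₁, (m₁ b : ℤ) = 0 := by
    rw [← hw₀, ← hw₁, hinv]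
    ring
  have h0₀ : ∀ a ∈ Z₀, (0 : ℤ) ≤ m₀ a := fun a _ => Int.natCast_nonneg _
  have h0₁ : ∀ b ∈ Z₁, (0 : ℤ) ≤ m₁ b := fun b _ => Int.natCast_nonneg _
  have hZ₀e : ∀ a, a ∉ Z₀ := fun a ha => by
    have h1 : (1 : ℤ) ≤ ∑ a ∈ Z₀, (m₀ a : ℤ) :=
      le_trans (by exact_mod_cast hm₀ a ha) (Finset.single_le_sum h0₀ ha)
    have h2 : (0 : ℤ) ≤ ∑ b ∈ Z₁, (m₁ b : ℤ) := Finset.sum_nonneg h0₁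
    omega
  have hZ₁e : ∀ b, b ∉ Z₁ := fun b hb => by
    have h1 : (1 : ℤ) ≤ ∑ b ∈ Z₁, (m₁ b : ℤ) :=
      le_trans (by exact_mod_cast hm₁ b hb) (Finset.single_le_sum h0₁ hb)
    have h2 : (0 : ℤ) ≤ ∑ a ∈ Z₀, (m₀ a : ℤ) := Finset.sum_nonneg h0₀
    omega
  -- Step 6: no zeros anywhere
  have hf₁ne : ∀ w : ℂ, ‖w‖ ≤ R⁻¹ → f₁ w ≠ 0 := fun w hw h0 => hZ₁e w (hmem₁ w hw h0)
  have hf₀ne : ∀ z : ℂ, f₀ z ≠ 0 := by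
    intro z hz
    rcases le_or_gt ‖z‖ R with hzR | hzR
    · exact hZ₀e z (hmem₀ z hzR hz)
    · have hz0 : z ≠ 0 := fun h => by
        rw [h, norm_zero] at hzR
        exact lt_asymm hR hzR
      refine hf₁ne z⁻¹ ?_ (by rw [hrel _ (inv_ne_zero hz0), inv_inv]; exact hz)
      rw [norm_inv]
      exact inv_anti₀ hR hzR.le
  refine ⟨hf₀ne, fun w => ?_⟩
  rcases eq_or_ne w 0 with rfl | hw0
  · exact hf₁ne 0 (by rw [norm_zero]; exact hRi.le)
  · rw [hrel w hw0]
    exact hf₀ne _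

end Literature.Analysis.Complex.RiemannSphere

end
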